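import Mathlib
import Literature.Barriers.ValiantsHypothesis.AlgebraicNaturalProofs
import Literature.Computability.AlgebraicComplexity.ArithCircuitProofs
import Summits.ValiantsHypothesis.ValiantsHypothesis.Theorems.BarrierLeverPartitionMinorsHitByVPCellDoor

/-!
# Route BarrierLever — item `PartitionMinorsHitByVP` (stmt-ValiantsHypothesis-19717):
# the DEPTH-TWO strata door — inner thresholds depending on the outer stratum, flattened into cells

Helper file (`--supports stmt-ValiantsHypothesis-19717`; cell valiant-natproofs, rung V4, 𝒟-side,
prover seat val-np-p6 gen 2). Definition-free, outside the theses cone. Closes NO item.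

A kernel instance of the flattening principle `…StrataDoor.lex_strict` (p475102): an OUTER threshold
pair `(λ₁, μ₁)` with `m₁` strata (monotone cuts `cr₁ / cc₁`, matching `π₁`) and, on each outer stratum
`t₁`, an INNER threshold pair `(λ₂ t₁, μ₂ t₁)` with `m₂` strata (cuts `cr₂ t₁ / cc₂ t₁`, matching
`π₂ t₁`) — inner functionals, cuts and matchings all depending on `t₁`, which ONE threshold pair cannot
express — is a single application of the cell door `…partitionMinor_hit_of_cells` with `m₁·m₂` cells
`t₁·m₂ + t₂`: the row scores are `(2M+1)·(K¹_{t₁} + 2t₁·λ₁(u)) + (K²_{t₁,t₂} + 2t₂·λ₂^{t₁}(u))` with the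
envelope offsets `K` of `…StrataDoor.envelope_lt` and `M` a bound on the inner scores; columns
likewise. Size `≤ Σ L(F t) + m₁m₂(2h+2)`: the budget counts the `m₁·m₂` LEAVES.

* **`partitionMinor_hit_of_strata_depthTwo`** — the door (ι-indexed; the matchings `π₁`, `π₂ t₁` are
  required injective on the whole index ranges `< m₁`, `< m₂`).

WHAT THIS IS NOT: gluing only; nothing on which layouts need depth two, on TT / 19616 / 19761, on
crux 14610 or on VP vs VNP.
-/

set_option linter.dupNamespace false

namespace Summit.ValiantsHypothesis.ValiantsHypothesis.Theorems.BarrierLever.StrataDoor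

open Finset
open Literature.Barriers.ValiantsHypothesis Literature.Computability.AlgebraicComplexity

/-- A member of a triple sum of absolute values is dominated by it. -/
theorem abs_le_sum_sum_sum {ι : Type*} [Fintype ι] (m₁ m₂ : ℕ) (E : ℕ → ℕ → ι → ℤ) (t₁ t₂ : ℕ)
    (ht₁ : t₁ < m₁) (ht₂ : t₂ < m₂) (i : ι) :
    |E t₁ t₂ i| ≤ ∑ i', ∑ s₁ ∈ Finset.range m₁, ∑ s₂ ∈ Finset.range m₂, |E s₁ s₂ i'| := by
  have h1 : |E t₁ t₂ i| ≤ ∑ s₂ ∈ Finset.range m₂, |E t₁ s₂ i| :=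
    Finset.single_le_sum (f := fun s₂ => |E t₁ s₂ i|) (fun _ _ => abs_nonneg _)
      (Finset.mem_range.mpr ht₂)
  have h2 : (∑ s₂ ∈ Finset.range m₂, |E t₁ s₂ i|) ≤
      ∑ s₁ ∈ Finset.range m₁, ∑ s₂ ∈ Finset.range m₂, |E s₁ s₂ i| :=
    Finset.single_le_sum (f := fun s₁ => ∑ s₂ ∈ Finset.range m₂, |E s₁ s₂ i|)
      (fun _ _ => Finset.sum_nonneg fun _ _ => abs_nonneg _) (Finset.mem_range.mpr ht₁)
  have h3 : (∑ s₁ ∈ Finset.range m₁, ∑ s₂ ∈ Finset.range m₂, |E s₁ s₂ i|) ≤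
      ∑ i', ∑ s₁ ∈ Finset.range m₁, ∑ s₂ ∈ Finset.range m₂, |E s₁ s₂ i'| :=
    Finset.single_le_sum (f := fun i' => ∑ s₁ ∈ Finset.range m₁, ∑ s₂ ∈ Finset.range m₂, |E s₁ s₂ i'|)
      (fun _ _ => Finset.sum_nonneg fun _ _ => Finset.sum_nonneg fun _ _ => abs_nonneg _)
      (Finset.mem_univ i)
  exact h1.trans (h2.trans h3)

/-- **The depth-two strata door.** Outer strata `lv₁ i < m₁` of the threshold pair `(lam₁, mu₁)`
(cuts `cr₁`, `cc₁`, column matching `π₁`), inner strata `lv₂ i < m₂` of the pair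
`(lam₂ (lv₁ i), mu₂ (lv₁ i))` depending on the outer stratum (cuts `cr₂ t₁`, `cc₂ t₁`, matching
`π₂ t₁`); per-leaf witnesses `F (t₁ * m₂ + t₂)` nonsingular on the leaves ⇒ one witness for the whole
layout matrix, size `≤ Σ_{t < m₁ m₂} L(F t) + m₁ m₂ (2h+2)`, degree `≤ max deg (F t)`. -/
theorem partitionMinor_hit_of_strata_depthTwo {ι : Type*} [Fintype ι] [DecidableEq ι] (h m₁ m₂ : ℕ)
    (u w : ι → Finset (Fin h))
    (lam₁ mu₁ : Fin h → ℤ) (lv₁ : ι → ℕ) (π₁ : ℕ → ℕ) (cr₁ cc₁ : ℕ → ℤ)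
    (hlv₁ : ∀ i, lv₁ i < m₁) (hπ₁ : ∀ t t', t < m₁ → t' < m₁ → π₁ t = π₁ t' → t = t')
    (hcr₁ : Monotone cr₁) (hcc₁ : Monotone cc₁)
    (hrow₁ : ∀ i, cr₁ (lv₁ i) < ∑ a ∈ u i, lam₁ a ∧ ∑ a ∈ u i, lam₁ a ≤ cr₁ (lv₁ i + 1))
    (hcol₁ : ∀ j, cc₁ (π₁ (lv₁ j)) < ∑ c ∈ w j, mu₁ c ∧ ∑ c ∈ w j, mu₁ c ≤ cc₁ (π₁ (lv₁ j) + 1))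
    (lam₂ mu₂ : ℕ → Fin h → ℤ) (lv₂ : ι → ℕ) (π₂ : ℕ → ℕ → ℕ) (cr₂ cc₂ : ℕ → ℕ → ℤ)
    (hlv₂ : ∀ i, lv₂ i < m₂)
    (hπ₂ : ∀ t₁, ∀ t t', t < m₂ → t' < m₂ → π₂ t₁ t = π₂ t₁ t' → t = t')
    (hcr₂ : ∀ t₁, Monotone (cr₂ t₁)) (hcc₂ : ∀ t₁, Monotone (cc₂ t₁))
    (hrow₂ : ∀ i, cr₂ (lv₁ i) (lv₂ i) < ∑ a ∈ u i, lam₂ (lv₁ i) a ∧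
      ∑ a ∈ u i, lam₂ (lv₁ i) a ≤ cr₂ (lv₁ i) (lv₂ i + 1))
    (hcol₂ : ∀ j, cc₂ (lv₁ j) (π₂ (lv₁ j) (lv₂ j)) < ∑ c ∈ w j, mu₂ (lv₁ j) c ∧
      ∑ c ∈ w j, mu₂ (lv₁ j) c ≤ cc₂ (lv₁ j) (π₂ (lv₁ j) (lv₂ j) + 1))
    (F : ℕ → MvPolynomial (Fin (h + h)) ℂ)
    (hdet : ∀ t < m₁ * m₂, (Matrix.of fun i j : {i // lv₁ i * m₂ + lv₂ i = t} => MvPolynomial.coeff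
        (∑ a ∈ u i.1, Finsupp.single (Fin.castAdd h a) 1 +
          ∑ c ∈ w j.1, Finsupp.single (Fin.natAdd h c) 1) (F t)).det ≠ 0) :
    ∃ f : MvPolynomial (Fin (h + h)) ℂ,
      f.totalDegree ≤ (Finset.range (m₁ * m₂)).sup (fun t => (F t).totalDegree) ∧
      complexity f ≤ ∑ t ∈ Finset.range (m₁ * m₂), complexity (F t) + (m₁ * m₂) * (h + h + 2) ∧
      (Matrix.of fun i j : ι => MvPolynomial.coeff
        (∑ a ∈ u i, Finsupp.single (Fin.castAdd h a) 1 +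
          ∑ c ∈ w j, Finsupp.single (Fin.natAdd h c) 1) f).det ≠ 0 := by
  classical
  -- envelope offsets
  set Kr₁ : ℕ → ℤ := fun t => -∑ s ∈ Finset.range t, (2 * cr₁ (s + 1) + 1) with hKr₁
  set Kc₁ : ℕ → ℤ := fun t => -∑ s ∈ Finset.range t, (2 * cc₁ (s + 1) + 1) with hKc₁
  set Kr₂ : ℕ → ℕ → ℤ := fun t₁ t => -∑ s ∈ Finset.range t, (2 * cr₂ t₁ (s + 1) + 1) with hKr₂
  set Kc₂ : ℕ → ℕ → ℤ := fun t₁ t => -∑ s ∈ Finset.range t, (2 * cc₂ t₁ (s + 1) + 1) with hKc₂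
  -- outer and inner scores of a row / column
  set E₁ : ℕ → ι → ℤ := fun t₁ i => Kr₁ t₁ + 2 * (t₁ : ℤ) * ∑ a ∈ u i, lam₁ a with hE₁
  set E₂ : ℕ → ℕ → ι → ℤ := fun t₁ t₂ i =>
    Kr₂ t₁ t₂ + 2 * (t₂ : ℤ) * ∑ a ∈ u i, lam₂ t₁ a with hE₂
  set G₁ : ℕ → ι → ℤ := fun t₁ j => Kc₁ (π₁ t₁) + 2 * ((π₁ t₁ : ℕ) : ℤ) * ∑ c ∈ w j, mu₁ c with hG₁
  set G₂ : ℕ → ℕ → ι → ℤ := fun t₁ t₂ j =>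
    Kc₂ t₁ (π₂ t₁ t₂) + 2 * ((π₂ t₁ t₂ : ℕ) : ℤ) * ∑ c ∈ w j, mu₂ t₁ c with hG₂
  -- uniform bounds on the inner scores
  set M : ℤ := ∑ i', ∑ s₁ ∈ Finset.range m₁, ∑ s₂ ∈ Finset.range m₂, |E₂ s₁ s₂ i'| with hM
  set M' : ℤ := ∑ j', ∑ s₁ ∈ Finset.range m₁, ∑ s₂ ∈ Finset.range m₂, |G₂ s₁ s₂ j'| with hM'
  -- the flattened affine scores
  set lam : ℕ → Fin h → ℤ := fun t a =>
    ((2 * M + 1) * (2 * ((t / m₂ : ℕ) : ℤ))) * lam₁ a + (2 * ((t % m₂ : ℕ) : ℤ)) * lam₂ (t / m₂) a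
    with hlam
  set kr : ℕ → ℤ := fun t => (2 * M + 1) * Kr₁ (t / m₂) + Kr₂ (t / m₂) (t % m₂) with hkr
  set mu : ℕ → Fin h → ℤ := fun t c =>
    ((2 * M' + 1) * (2 * ((π₁ (t / m₂) : ℕ) : ℤ))) * mu₁ c +
      (2 * ((π₂ (t / m₂) (t % m₂) : ℕ) : ℤ)) * mu₂ (t / m₂) c with hmu
  set kc : ℕ → ℤ := fun t => (2 * M' + 1) * Kc₁ (π₁ (t / m₂)) + Kc₂ (t / m₂) (π₂ (t / m₂) (t % m₂))
    with hkc
  have hscore_row : ∀ t i, kr t + ∑ a ∈ u i, lam t a =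
      (2 * M + 1) * E₁ (t / m₂) i + E₂ (t / m₂) (t % m₂) i := by
    intro t i
    simp only [hkr, hlam, hE₁, hE₂]
    rw [Finset.sum_add_distrib, ← Finset.mul_sum, ← Finset.mul_sum]
    ring
  have hscore_col : ∀ t j, kc t + ∑ c ∈ w j, mu t c =
      (2 * M' + 1) * G₁ (t / m₂) j + G₂ (t / m₂) (t % m₂) j := by
    intro t j
    simp only [hkc, hmu, hG₁, hG₂]
    rw [Finset.sum_add_distrib, ← Finset.mul_sum, ← Finset.mul_sum]
    ring
  -- lexicographic strictness on each side
  have hlex_row : ∀ i, lv₁ i * m₂ + lv₂ i < m₁ * m₂ ∧ ∀ t < m₁ * m₂, t ≠ lv₁ i * m₂ + lv₂ i →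
      (2 * M + 1) * E₁ (t / m₂) i + E₂ (t / m₂) (t % m₂) i <
        (2 * M + 1) * E₁ ((lv₁ i * m₂ + lv₂ i) / m₂) i +
          E₂ ((lv₁ i * m₂ + lv₂ i) / m₂) ((lv₁ i * m₂ + lv₂ i) % m₂) i := by
    intro i
    refine lex_strict m₁ m₂ (fun t₁ => E₁ t₁ i) (fun t₁ t₂ => E₂ t₁ t₂ i) M (lv₁ i) (lv₂ i)
      (hlv₁ i) (hlv₂ i) (fun t₁ ht₁ hne => ?_) (fun t₂ ht₂ hne => ?_) (fun t₁ ht₁ t₂ ht₂ => ?_)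
    · exact envelope_lt cr₁ hcr₁ _ (lv₁ i) (hrow₁ i).1 (hrow₁ i).2 t₁ hne
    · exact envelope_lt (cr₂ (lv₁ i)) (hcr₂ _) _ (lv₂ i) (hrow₂ i).1 (hrow₂ i).2 t₂ hne
    · exact abs_le_sum_sum_sum m₁ m₂ E₂ t₁ t₂ ht₁ ht₂ i
  have hlex_col : ∀ j, lv₁ j * m₂ + lv₂ j < m₁ * m₂ ∧ ∀ t < m₁ * m₂, t ≠ lv₁ j * m₂ + lv₂ j →
      (2 * M' + 1) * G₁ (t / m₂) j + G₂ (t / m₂) (t % m₂) j <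
        (2 * M' + 1) * G₁ ((lv₁ j * m₂ + lv₂ j) / m₂) j +
          G₂ ((lv₁ j * m₂ + lv₂ j) / m₂) ((lv₁ j * m₂ + lv₂ j) % m₂) j := by
    intro j
    refine lex_strict m₁ m₂ (fun t₁ => G₁ t₁ j) (fun t₁ t₂ => G₂ t₁ t₂ j) M' (lv₁ j) (lv₂ j)
      (hlv₁ j) (hlv₂ j) (fun t₁ ht₁ hne => ?_) (fun t₂ ht₂ hne => ?_) (fun t₁ ht₁ t₂ ht₂ => ?_)
    · exact envelope_lt cc₁ hcc₁ _ (π₁ (lv₁ j)) (hcol₁ j).1 (hcol₁ j).2 (π₁ t₁)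
        (fun hh => hne (hπ₁ _ _ ht₁ (hlv₁ j) hh))
    · exact envelope_lt (cc₂ (lv₁ j)) (hcc₂ _) _ (π₂ (lv₁ j) (lv₂ j)) (hcol₂ j).1 (hcol₂ j).2
        (π₂ (lv₁ j) t₂) (fun hh => hne (hπ₂ _ _ _ ht₂ (hlv₂ j) hh))
    · exact abs_le_sum_sum_sum m₁ m₂ G₂ t₁ t₂ ht₁ ht₂ j
  -- the cell door with `m₁ * m₂` cells
  refine partitionMinor_hit_of_cells h (m₁ * m₂) u w lam mu kr kc (fun i => lv₁ i * m₂ + lv₂ i)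
    (fun i => (hlex_row i).1) (fun i t ht hne => ?_) (fun j t ht hne => ?_) F hdet
  · rw [hscore_row, hscore_row]
    exact (hlex_row i).2 t ht hne
  · rw [hscore_col, hscore_col]
    exact (hlex_col j).2 t ht hne

end Summit.ValiantsHypothesis.ValiantsHypothesis.Theorems.BarrierLever.StrataDoor
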